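import Literature.Probability.LatticeModels.DecoratedCurrentObservable
import Mathlib.Algebra.Polynomial.Eval.Defs
import HarnessLib

/-!
# The local identity matrix of the `SU(2)`-decorated current observable

Topic `Literature/Probability/LatticeModels`, namespace `Literature.Probability.LatticeModels`
(auxiliary objects in the sub-namespace `….LocalIdentity`). Definition request
`defn-LocalIdentityMatrix` of route `DiracCensus` (summit CriticalPhenomena, sub-problem
Ising3DConformalLimit, card `dirac-census-algebraic-betac`; items `SpinorIdentityExists`,
`NoShortRangeSpinorIdentity`), built on `DecoratedCurrentObservable.lean` (request D1 of the same
route: currents, the canonical backbone `Current.backbone`, the splitting rule `latticeRank`, the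
spin-½ holonomy `holonomy` of a lattice word).

## The object

Fix a finite region `R ⊂ ℤ³` (the stencil, placed at the origin; by translation invariance of
`latticeRank` the matrix at `z + R` is the same; probes range over all of `R`, and a stencil
strictly inside a larger region is the corresponding column-submatrix) and a depth `k`. A *decoration* of depth `k` of a
backbone word (its list of steps) is the pair (arrival direction = last step, spin-½ holonomy of
the last `k` steps) (`decoration`); the *alphabet* `𝒜_k = decorationAlphabet k` is the finite set
of decorations of reversal-free words in the six lattice directions. The decorated observable of
D1 splits accordingly, `F_t(a; z) = ∑_{α} F^α_t(a; z)` with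
`F^α = Z⁻¹ ∑_{∂n = {a} ∆ {z}, dec_k(γ(n)) = α} t^{|n|} Hol(γ(n))` (`decoratedClassSum`).

A candidate identity of the route is `∑_{(u,α) ∈ R × 𝒜_k} F^α_t(a; z + u) c_{u,α} = 0` with spinor
coefficients `c_{u,α} ∈ ℂ²` acting on the right (the holonomy is the ordered product of turn
factors from the source to the probe, so the factor produced near the probe is the right-most
one). Its *local certificate* is organised, as in Ikhlef–Cardy 2009, §3 ("consider the
contributions … where the first time the oriented curve enters the chosen plaquette is through a
particular edge …; we imagine [the external data] to be fixed, summing over all internal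
configurations consistent with them; this yields the linear system"), by **boundary patterns**:

* a *row* `π = (P, e, ι)` (`LocalIdentity.Row R k`) records the set `P` of boundary bonds of `R`
  (bonds `{v, w}`, `v ∈ R ∌ w`, written as arrows `(v, w)`) carrying an odd current, the arrow
  `e ∈ P` through which the backbone first enters `R`, and the word `ι` of the `k - 1` lattice
  steps of the backbone preceding the entry step (enough to evaluate every decoration of depth `k`
  at a probe inside; reversal-free together with the entry step);
* a *column* is `((u, α), j)`: probe `u ∈ R`, decoration `α ∈ 𝒜_k`, spinor index `j : Fin 2`;
  rows likewise carry a spinor index `i : Fin 2`, so that the `2 × 2` blocks are flattened into a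
  matrix over the scalars;
* the entry at `((π, i), ((u, α), j))` is the **local partition polynomial**
  `∑_{η} X^{|η|} · Hol(ι · γ_loc)_{ij}` over the sets `η` of bonds inside `R` carrying an odd
  current (`{0,1}`-configurations; see *Weights* below) that are *compatible* with `(π, u)` —
  every vertex of `R` has even `(η ∪ P)`-degree except `u`, which is odd, and the canonical
  exploration of D1, run on the local graph `R ∪ {boundary stubs}` from the entry stub of `e`
  towards `u` with the same splitting rule `latticeRank`, ends at `u` — and whose local backbone
  word `ι · γ_loc` (incoming letters, entry step, inside steps) has decoration `α`
  (`localIdentityMatrix`, entries in `ℂ[X]`; the coefficients are products of entries of turn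
  factors `(1/√2)(1 - i (u × v)·σ)`, i.e. lie in `ℤ[1/√2, i]`).

`M(t) = localIdentityMatrix R k` evaluated at `X = t` (`localIdentityMatrix_map_eval`); a vector
`c : (R × 𝒜_k) × Fin 2 → ℂ` is the family of spinors `c_{u,α} = (c ((u,α),0), c ((u,α),1))`, and
`(M(t) c)_{(π,i)} = ∑_{(u,α)} (Block_{π,(u,α)}(t) c_{u,α})_i`.

## Bookkeeping lemmas

`localIdentityMatrix_apply`, `localIdentityMatrix_map_eval` (the matrix at `X = t`);
`LocalIdentity.odd_bond_current_inl_inl` / `…_inl_inr` / `…_inr` (the local current read on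
inside and stub bonds), `LocalIdentity.inr_mem_sources_current_iff` (a stub is a source iff its
arrow is odd), `LocalIdentity.exists_word_eq_append_cons` (a compatible local word is the incoming
word, the entry step, then inside steps), `LocalIdentity.compatible_iff_of_odd_eq_singleton`
(principal rows `P = {e}`: compatibility is the degree condition, by Aizenman's parity observation
`Current.backboneEnd_eq_of_sources_eq`), `unitVec_one_mem_decorationAlphabet` /
`decorationAlphabet_nonempty` / `nonempty_col` (the straight decorations `(±eᵢ, 1)` lie in every
`𝒜_k`).

## Design choices

* **Local graph.** `LocalIdentity.graph R` has vertices `R ⊕ arrows R`: the sites of `R` with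
  their `ℤ³` adjacency, and one pendant *stub* per boundary arrow `(v, w)`, attached to `v` and
  positioned at `w` (`LocalIdentity.pos`), so that `latticeRank pos` is the splitting rule of D1
  read inside `R`. A local run that steps onto a stub other than the entry has *left the region*:
  it halts there (the stub has no further bond), the configuration is not compatible, and it
  contributes to no entry.
* **What a row fixes, and what it does not.** A row fixes first-entry data only. For an outside
  configuration whose backbone enters `R` once, the inside sum it multiplies (on the right of the
  invertible holonomy accumulated before entry, and of `t^{|n_out|}`) is exactly the row of
  blocks, so `M(t) c = 0` makes all such grouped contributions vanish; when `P = {e}` no exit is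
  possible and compatibility is just the degree condition
  (`LocalIdentity.compatible_iff_of_odd_eq_singleton`). Configurations whose backbone leaves
  `R` through another odd boundary bond and re-enters later are dropped by every row (their
  inside trajectory and weight depend on how the outside routes the excursion — in the planar
  loop model this is the "external connectivity" of Ikhlef–Cardy, a finite non-crossing matching
  with quantised winding; for a trail in `ℤ³` it would be a response tree carrying `2O`-valued
  holonomies). The equivalence "identity on every graph locally isomorphic to `ℤ³` around `z + R`
  iff `M(t) c(t) = 0`" stated in the request is the route's claim (items `SpinorIdentityExists`,
  `NoShortRangeSpinorIdentity`), not a theorem of this file.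
* **Weights.** Entries are polynomials: the inside configuration is summed over parity patterns
  `η ⊆ E(R)` with weight `X^{|η|}`. Summing instead over all `ℕ`-valued inside currents with
  weight `t^{|n_in|}` (as in D1) multiplies every entry by the same factor `(1 - t²)^{-|E(R)|}`,
  since compatibility, the local backbone and its holonomy only depend on parities; the kernel is
  unchanged.
* **Incoming word.** `ι` has exactly `k - 1` letters (`Fin (k - 1)`, so none for `k ≤ 1`): a
  decoration of depth `k` at a probe reads at most `k - 1` steps before the entry step. A shorter
  true history (source adjacent to the region) is represented by padding on the left with copies
  of the first letter, which changes no decoration (`spinTurn_self`). The holonomy recorded in an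
  entry is that of the whole word `ι · γ_loc`; replacing it by the holonomy from the entry step on
  multiplies the row on the left by the invertible `Hol(ι) h(ι_last, entry)`, same kernel.
* **Alphabet.** `𝒜_k` is the image of `decoration k` on reversal-free words of length
  `max k 1` in the six unit directions; every reversal-free non-empty word of any length has its
  decoration in `𝒜_k` (pad or truncate on the left). For `k ≤ 1` it is the set of the six
  arrival directions with trivial holonomy class. Decorations are compared as elements of
  `ℤ³ × M₂(ℂ)` (classical decidability).
* **Junk values.** `decoration k []` is `(0, 1)`; a probe `u` that no compatible configuration
  reaches gives a zero column; `R = ∅` gives empty index types.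

## What is not here

No statement relating `ker M(t)` to identities of `decoratedCurrentObservable` (soundness for
single-passage configurations, completeness, realisability of rows), no symbol / ellipticity
notions (the route's `DichotomyLemma` is stated over explicit trigonometric polynomials), no
planar `U(1)` control (Smirnov's s-holomorphicity coefficients in the kernel of the `ℤ²`
analogue; Ikhlef–Cardy's `5 × 5` determinant), no evaluation of any entry. This is a posited
object of a route (a certificate-search matrix), recorded with bookkeeping lemmas only.

## References

* Y. Ikhlef, J. Cardy, *Discretely holomorphic parafermions and integrable loop models*,
  J. Phys. A 42 (2009) 102001, §3 (local linear system from fixed external connectivities; the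
  `5 × 5` determinant) [IkhlefCardy2009].
* M. A. Rajabpour, J. Cardy, *Discretely holomorphic parafermions in lattice `Z_N` models*,
  J. Phys. A 40 (2007) 14703 [RajabpourCardy2007].
* M. Aizenman, Comm. Math. Phys. 86 (1982), §9 (the backbone exploration) [AizenmanCMP1982].
-/

noncomputable section

open Finset Matrix
open scoped symmDiff Polynomial

namespace Literature.Probability.LatticeModels

/-! ### Decorations of backbone words -/

/-- A word of lattice steps is *reversal-free* if no step is followed by its opposite (as along
any trail of a graph drawn injectively in `ℤ³` with nearest-neighbour bonds). [folklore] -/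
def NoReversal (W : List (Site 3)) : Prop :=
  W.IsChain fun a b => a + b ≠ 0

/-- Reversal-freeness is decidable. [folklore] -/
instance : DecidablePred NoReversal := fun W =>
  inferInstanceAs (Decidable (W.IsChain fun a b => a + b ≠ 0))

/-- The **decoration of depth `k`** of a backbone word `W = [d₁, …, d_m]` (its steps, source to
probe): the arrival direction `d_m` at the probe together with the spin-½ holonomy of the last
`k` steps `[d_{m-k+1}, …, d_m]` (the whole word if `m < k`; trivial for `k ≤ 1`). Junk value
`(0, 1)` on the empty word. [folklore] -/
def decoration (k : ℕ) (W : List (Site 3)) : Site 3 × Matrix (Fin 2) (Fin 2) ℂ :=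
  (W.getLastD 0, holonomy (W.drop (W.length - k)))

open scoped Classical in
/-- The **decoration alphabet** `𝒜_k`: the decorations of depth `k` of the reversal-free words of
length `max k 1` in the six unit lattice directions (arrival direction × holonomy class of the
last `k` steps, an element of the binary octahedral group). [folklore] -/
def decorationAlphabet (k : ℕ) : Finset (Site 3 × Matrix (Fin 2) (Fin 2) ℂ) :=
  ((univ : Finset (Fin (max k 1) → Fin 3 × Bool)).filter
      fun w => NoReversal ((List.ofFn w).map unitVec)).image
    fun w => decoration k ((List.ofFn w).map unitVec)

/-- Unfolding of `decoration`. [folklore] -/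
theorem decoration_apply (k : ℕ) (W : List (Site 3)) :
    decoration k W = (W.getLastD 0, holonomy (W.drop (W.length - k))) := rfl

/-- A unit lattice vector is not its own opposite: `u + u ≠ 0`. [folklore] -/
theorem unitVec_add_self_ne_zero (p : Fin 3 × Bool) : unitVec p + unitVec p ≠ 0 := by
  intro h
  have h1 := congr_fun h p.1
  rcases p with ⟨i, b⟩
  cases b <;> simp [unitVec] at h1

/-- A unit lattice vector is non-zero. [folklore] -/
theorem unitVec_dir_ne_zero (p : Fin 3 × Bool) : unitVec p ≠ 0 := by
  intro h
  have h1 := congr_fun h p.1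
  rcases p with ⟨i, b⟩
  cases b <;> simp [unitVec] at h1

/-- A straight word is reversal-free. [folklore] -/
theorem noReversal_replicate (m : ℕ) (p : Fin 3 × Bool) :
    NoReversal (List.replicate m (unitVec p)) :=
  List.isChain_replicate_of_rel m (unitVec_add_self_ne_zero p)

/-- The decoration of a non-empty straight word: its direction, trivial holonomy class. [folklore] -/
theorem decoration_replicate (k : ℕ) {m : ℕ} (hm : m ≠ 0) (p : Fin 3 × Bool) :
    decoration k (List.replicate m (unitVec p)) = (unitVec p, 1) := by
  rw [decoration_apply, List.drop_replicate, holonomy_replicate (unitVec_dir_ne_zero p),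
    List.getLastD_eq_getLast?, List.getLast?_replicate, if_neg hm]
  rfl

/-- **The alphabet is not empty**: every arrival direction with trivial holonomy class,
`(±eᵢ, 1)`, is a decoration of depth `k` (of a straight word). [folklore] -/
theorem unitVec_one_mem_decorationAlphabet (k : ℕ) (p : Fin 3 × Bool) :
    (unitVec p, (1 : Matrix (Fin 2) (Fin 2) ℂ)) ∈ decorationAlphabet k := by
  classical
  rw [decorationAlphabet, mem_image]
  refine ⟨fun _ => p, ?_, ?_⟩
  · rw [mem_filter, List.ofFn_const, List.map_replicate]
    exact ⟨mem_univ _, noReversal_replicate _ p⟩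
  · rw [List.ofFn_const, List.map_replicate]
    exact decoration_replicate k (by omega) p

/-- The decoration alphabet is non-empty. [folklore] -/
theorem decorationAlphabet_nonempty (k : ℕ) : (decorationAlphabet k).Nonempty :=
  ⟨_, unitVec_one_mem_decorationAlphabet k (0, true)⟩

/-! ### The decorated observable split by decoration class -/

section ClassSum

variable {V : Type*} [Fintype V] (G : SimpleGraph V) [DecidableRel G.Adj] [DecidableEq V]

open scoped Classical in
/-- The **decoration class sum** `∑_{n : ∂n = {a} ∆ {z}, dec_k(γ(n)) = α} t^{|n|} Hol(γ(n))`: the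
part of `decoratedCurrentSum G pos t a z` carried by the currents whose canonical backbone from
`a` to `z` (drawn by `pos`) has decoration `α` of depth `k` at the probe; dividing by
`currentSizeSum G t ∅` gives the class component `F^α_t(a; z)` of the decorated observable.
[folklore] -/
def decoratedClassSum (pos : V → Site 3) (t : ℝ) (a z : V) (k : ℕ)
    (α : Site 3 × Matrix (Fin 2) (Fin 2) ℂ) : Matrix (Fin 2) (Fin 2) ℂ :=
  ∑' n : Current G,
    if n.sources = {a} ∆ {z} ∧
        decoration k (steps ((n.backbone (latticeRank pos) a z).map pos)) = α then
      ((t : ℂ) ^ n.size) • n.hol pos a z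
    else 0

end ClassSum

/-! ### The local graph of a region of `ℤ³` -/

namespace LocalIdentity

variable (R : Finset (Site 3))

/-- The boundary arrows of the region `R`: ordered pairs `(v, w)` of adjacent sites with `v ∈ R`
and `w ∉ R` (one per boundary bond of `R` in `ℤ³`). [folklore] -/
def arrows : Finset (Site 3 × Site 3) :=
  (R ×ˢ outerBoundary (zdGraph 3) R).filter fun p => (zdGraph 3).Adj p.1 p.2

variable {R} in
/-- Membership in `arrows`. [folklore] -/
theorem mem_arrows_iff {p : Site 3 × Site 3} :
    p ∈ arrows R ↔ p.1 ∈ R ∧ p.2 ∉ R ∧ (zdGraph 3).Adj p.1 p.2 := by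
  simp only [arrows, mem_filter, mem_product, mem_outerBoundary_iff]
  constructor
  · rintro ⟨⟨h1, h2, _⟩, h3⟩
    exact ⟨h1, h2, h3⟩
  · rintro ⟨h1, h2, h3⟩
    exact ⟨⟨h1, h2, p.1, h1, h3.symm⟩, h3⟩

/-- The type of boundary arrows of `R`. [folklore] -/
abbrev Arrow : Type := ↥(arrows R)

/-- The vertices of the local graph: the sites of `R` and one stub per boundary arrow. [folklore] -/
abbrev Vertex : Type := ↥R ⊕ Arrow R

/-- The position of a local vertex in `ℤ³`: a site of `R` sits at itself, the stub of the arrow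
`(v, w)` at its outer end `w`. [folklore] -/
def pos : Vertex R → Site 3 :=
  Sum.elim (fun x => x.1) fun p => p.1.2

/-- Position of a site of `R`. [folklore] -/
@[simp] theorem pos_inl (x : ↥R) : pos R (Sum.inl x) = x.1 := rfl

/-- Position of a stub. [folklore] -/
@[simp] theorem pos_inr (p : Arrow R) : pos R (Sum.inr p) = p.1.2 := rfl

/-- The generating adjacency of the local graph (symmetrised by `SimpleGraph.fromRel`): `ℤ³`
adjacency between sites of `R`, and each stub `(v, w)` attached to its inner end `v`. [folklore] -/
def AdjRel : Vertex R → Vertex R → Prop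
  | Sum.inl x, Sum.inl y => (zdGraph 3).Adj x.1 y.1
  | Sum.inl x, Sum.inr p => p.1.1 = x.1
  | Sum.inr _, _ => False

/-- The generating adjacency is decidable. [folklore] -/
instance : DecidableRel (AdjRel R)
  | Sum.inl x, Sum.inl y => inferInstanceAs (Decidable ((zdGraph 3).Adj x.1 y.1))
  | Sum.inl x, Sum.inr p => inferInstanceAs (Decidable (p.1.1 = x.1))
  | Sum.inr _, Sum.inl _ => inferInstanceAs (Decidable False)
  | Sum.inr _, Sum.inr _ => inferInstanceAs (Decidable False)

/-- **The local graph of the region `R`**: the induced `ℤ³` graph on `R` together with one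
pendant stub per boundary bond. [folklore] -/
def graph : SimpleGraph (Vertex R) := SimpleGraph.fromRel (AdjRel R)

/-- Adjacency in the local graph is decidable. [folklore] -/
instance : DecidableRel (graph R).Adj := fun a b =>
  inferInstanceAs (Decidable (a ≠ b ∧ (AdjRel R a b ∨ AdjRel R b a)))

variable {R}

/-- Two sites of `R` are adjacent in the local graph iff they are in `ℤ³`. [folklore] -/
@[simp] theorem graph_adj_inl_inl {x y : ↥R} :
    (graph R).Adj (Sum.inl x) (Sum.inl y) ↔ (zdGraph 3).Adj x.1 y.1 := by
  rw [graph, SimpleGraph.fromRel_adj]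
  change _ ∧ ((zdGraph 3).Adj x.1 y.1 ∨ (zdGraph 3).Adj y.1 x.1) ↔ _
  constructor
  · rintro ⟨_, h | h⟩
    · exact h
    · exact h.symm
  · intro h
    exact ⟨fun hxy => h.ne (by rw [Sum.inl_injective hxy]), Or.inl h⟩

/-- A site of `R` is adjacent to a stub iff the stub's arrow starts at it. [folklore] -/
@[simp] theorem graph_adj_inl_inr {x : ↥R} {p : Arrow R} :
    (graph R).Adj (Sum.inl x) (Sum.inr p) ↔ p.1.1 = x.1 := by
  rw [graph, SimpleGraph.fromRel_adj]
  change _ ∧ (p.1.1 = x.1 ∨ False) ↔ _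
  simp

/-- Symmetric form of `graph_adj_inl_inr`. [folklore] -/
@[simp] theorem graph_adj_inr_inl {x : ↥R} {p : Arrow R} :
    (graph R).Adj (Sum.inr p) (Sum.inl x) ↔ p.1.1 = x.1 := by
  rw [SimpleGraph.adj_comm, graph_adj_inl_inr]

/-- Stubs are never adjacent to each other. [folklore] -/
@[simp] theorem not_graph_adj_inr_inr {p q : Arrow R} :
    ¬(graph R).Adj (Sum.inr p) (Sum.inr q) := by
  rw [graph, SimpleGraph.fromRel_adj]
  rintro ⟨_, h | h⟩ <;> exact h

/-! ### The local current of a boundary pattern and an inside configuration -/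

variable (R)

/-- The parity pattern of the local current determined by the odd boundary arrows `P` and the
odd inside bonds `η`, as a symmetric Boolean function of the two ends. [folklore] -/
def parity (P : Finset (Arrow R)) (η : Finset (Sym2 (Site 3))) : Vertex R → Vertex R → Bool
  | Sum.inl x, Sum.inl y => decide (s(x.1, y.1) ∈ η)
  | Sum.inl _, Sum.inr p => decide (p ∈ P)
  | Sum.inr p, Sum.inl _ => decide (p ∈ P)
  | Sum.inr _, Sum.inr _ => false

/-- The parity pattern is symmetric. [folklore] -/
theorem parity_comm (P : Finset (Arrow R)) (η : Finset (Sym2 (Site 3))) :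
    ∀ a b, parity R P η a b = parity R P η b a := by
  rintro (x | p) (y | q) <;> simp [parity, Sym2.eq_swap]

/-- **The local current** of the boundary pattern `P` (odd boundary arrows) and the inside
configuration `η` (odd inside bonds): the `{0,1}`-valued current on the local graph equal to `1`
exactly on the stub bonds of arrows in `P` and on the inside bonds in `η`. [folklore] -/
def current (P : Finset (Arrow R)) (η : Finset (Sym2 (Site 3))) : Current (graph R) :=
  fun e => (Sym2.lift ⟨parity R P η, parity_comm R P η⟩ (e : Sym2 (Vertex R))).toNat

variable {R}

/-- Parity of a Boolean read as a natural number. [folklore] -/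
theorem odd_toNat_iff (b : Bool) : Odd b.toNat ↔ b = true := by
  cases b <;> simp

/-- The local current on a pair of local vertices: the parity pattern if they are adjacent,
`0` otherwise. [folklore] -/
theorem bond_current (P : Finset (Arrow R)) (η : Finset (Sym2 (Site 3))) (a b : Vertex R) :
    (current R P η).bond s(a, b) = if (graph R).Adj a b then (parity R P η a b).toNat else 0 := by
  unfold Current.bond
  by_cases h : (graph R).Adj a b
  · rw [if_pos h, dif_pos ((SimpleGraph.mem_edgeFinset).2 h)]
    simp [current]
  · rw [if_neg h, dif_neg (fun h' => h ((SimpleGraph.mem_edgeFinset).1 h'))]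

/-- **Inside bonds**: the local current is odd on `{x, y} ⊆ R` iff `x ∼ y` and `{x, y} ∈ η`. [folklore] -/
theorem odd_bond_current_inl_inl (P : Finset (Arrow R)) (η : Finset (Sym2 (Site 3))) (x y : ↥R) :
    Odd ((current R P η).bond s(Sum.inl x, Sum.inl y)) ↔
      (zdGraph 3).Adj x.1 y.1 ∧ s(x.1, y.1) ∈ η := by
  rw [bond_current]
  split_ifs with h
  · rw [odd_toNat_iff]
    change decide (s(x.1, y.1) ∈ η) = true ↔ _
    rw [decide_eq_true_iff]
    exact ⟨fun hm => ⟨graph_adj_inl_inl.1 h, hm⟩, fun hm => hm.2⟩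
  · constructor
    · intro h0
      exact absurd h0 (by simp)
    · intro hm
      exact absurd (graph_adj_inl_inl.2 hm.1) h

/-- **Boundary bonds**: the local current is odd on the stub bond of the arrow `p` at `x` iff
`p` starts at `x` and `p ∈ P`. [folklore] -/
theorem odd_bond_current_inl_inr (P : Finset (Arrow R)) (η : Finset (Sym2 (Site 3))) (x : ↥R)
    (p : Arrow R) :
    Odd ((current R P η).bond s(Sum.inl x, Sum.inr p)) ↔ p.1.1 = x.1 ∧ p ∈ P := by
  rw [bond_current]
  split_ifs with h
  · rw [odd_toNat_iff]
    change decide (p ∈ P) = true ↔ _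
    rw [decide_eq_true_iff]
    exact ⟨fun hm => ⟨graph_adj_inl_inr.1 h, hm⟩, fun hm => hm.2⟩
  · constructor
    · intro h0
      exact absurd h0 (by simp)
    · intro hm
      exact absurd (graph_adj_inl_inr.2 hm.1) h

/-- **Stub bonds from the stub's side**: the local current is odd on a pair `{stub p, b}` iff `b`
is the inner end of `p` and `p ∈ P`. [folklore] -/
theorem odd_bond_current_inr (P : Finset (Arrow R)) (η : Finset (Sym2 (Site 3))) (p : Arrow R)
    (b : Vertex R) :
    Odd ((current R P η).bond s(Sum.inr p, b)) ↔ ∃ x : ↥R, b = Sum.inl x ∧ p.1.1 = x.1 ∧ p ∈ P := by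
  rcases b with x | q
  · rw [Sym2.eq_swap, odd_bond_current_inl_inr]
    constructor
    · rintro ⟨h1, h2⟩
      exact ⟨x, rfl, h1, h2⟩
    · rintro ⟨y, hy, h1, h2⟩
      cases Sum.inl_injective hy
      exact ⟨h1, h2⟩
  · rw [bond_current, if_neg not_graph_adj_inr_inr]
    simp

/-- **The degree of a stub** is the parity of its arrow: the bonds of odd current at the stub of
`p` are `{p, inner end}` if `p ∈ P` and none otherwise. [folklore] -/
theorem oddBondsAt_current_inr (P : Finset (Arrow R)) (η : Finset (Sym2 (Site 3))) (p : Arrow R) :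
    (current R P η).oddBondsAt (Sum.inr p) =
      if p ∈ P then {s(Sum.inr p, Sum.inl ⟨p.1.1, (mem_arrows_iff.1 p.2).1⟩)} else ∅ := by
  ext e
  simp only [Current.oddBondsAt, mem_filter, mem_univ, true_and]
  induction e using Sym2.ind with
  | _ a b =>
    constructor
    · rintro ⟨hmem, hodd⟩
      have key : ∀ c, Odd ((current R P η).bond s(Sum.inr p, c)) →
          s(Sum.inr p, c) ∈ (if p ∈ P then
            ({s(Sum.inr p, Sum.inl ⟨p.1.1, (mem_arrows_iff.1 p.2).1⟩)} : Finset (Sym2 (Vertex R)))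
            else ∅) := by
        intro c hc
        obtain ⟨x, rfl, hx, hP⟩ := (odd_bond_current_inr P η p c).1 hc
        rw [if_pos hP, mem_singleton]
        congr
        exact Subtype.ext hx.symm
      rcases Sym2.mem_iff.1 hmem with h | h
      · subst h
        exact key b hodd
      · subst h
        rw [show s(a, Sum.inr p) = s(Sum.inr p, a) from Sym2.eq_swap] at hodd ⊢
        exact key a hodd
    · intro h
      split_ifs at h with hP
      · rw [mem_singleton] at h
        rw [h]
        exact ⟨Sym2.mem_mk_left _ _, (odd_bond_current_inr P η p _).2 ⟨_, rfl, rfl, hP⟩⟩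
      · exact absurd h (Finset.notMem_empty _)

/-- **A stub is a source of the local current iff its arrow is odd.** [folklore] -/
theorem inr_mem_sources_current_iff (P : Finset (Arrow R)) (η : Finset (Sym2 (Site 3)))
    (p : Arrow R) : Sum.inr p ∈ (current R P η).sources ↔ p ∈ P := by
  rw [Current.mem_sources_iff_odd_card_oddBondsAt, oddBondsAt_current_inr]
  split_ifs with hP
  · simp [hP]
  · simp [hP]

/-! ### Rows, columns and the local run -/

variable (R)

/-- **Boundary patterns (rows).** A row `π = (P, e, ι)` consists of the set `P` of boundary
arrows carrying an odd current, the entry arrow `e ∈ P` of the backbone, and the `k - 1` lattice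
letters `ι` of the backbone preceding the entry step `e.1 - e.2` (inner end minus outer end),
the word `ι · [e.1 - e.2]` being reversal-free. [folklore] -/
abbrev Row (k : ℕ) : Type :=
  {r : Finset (Arrow R) × Arrow R × (Fin (k - 1) → Fin 3 × Bool) //
    r.2.1 ∈ r.1 ∧ NoReversal ((List.ofFn r.2.2).map unitVec ++ [r.2.1.1.1 - r.2.1.1.2])}

/-- **Columns**: a probe `u ∈ R` and a decoration `α ∈ 𝒜_k`. [folklore] -/
abbrev Col (k : ℕ) : Type := ↥R × ↥(decorationAlphabet k)

variable {R} {k : ℕ}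

/-- The odd boundary arrows of a row. [folklore] -/
def Row.odd (r : Row R k) : Finset (Arrow R) := r.1.1

/-- The entry arrow of a row. [folklore] -/
def Row.entry (r : Row R k) : Arrow R := r.1.2.1

/-- The incoming word of a row, as lattice vectors. [folklore] -/
def Row.incoming (r : Row R k) : List (Site 3) := (List.ofFn r.1.2.2).map unitVec

/-- The entry arrow of a row carries an odd current. [folklore] -/
theorem Row.entry_mem_odd (r : Row R k) : r.entry ∈ r.odd := r.2.1

/-- **The local run**: the canonical backbone of D1 (`Current.backbone`, splitting rule
`latticeRank pos`) of the local current of the row `r` and the inside configuration `η`, started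
at the entry stub and aimed at the probe `u`. [folklore] -/
def localBackbone (r : Row R k) (u : ↥R) (η : Finset (Sym2 (Site 3))) : List (Vertex R) :=
  (current R r.odd η).backbone (latticeRank (pos R)) (Sum.inr r.entry) (Sum.inl u)

/-- **The local backbone word** `ι · γ_loc`: the incoming letters followed by the steps of the
local run (the first of which is the entry step). [folklore] -/
def word (r : Row R k) (u : ↥R) (η : Finset (Sym2 (Site 3))) : List (Site 3) :=
  r.incoming ++ steps ((localBackbone r u η).map (pos R))

/-- **Compatibility** of an inside configuration `η` with the row `r` and the probe `u`: every
site of `R` has even degree in the local current except `u`, which has odd degree (so that,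
glued to an outside current entering through `r.odd`, the sources inside `R` are exactly `{u}`),
and the local run ends at `u` (it neither leaves `R` through another odd boundary bond nor halts
elsewhere). [folklore] -/
def Compatible (r : Row R k) (u : ↥R) (η : Finset (Sym2 (Site 3))) : Prop :=
  (∀ v : ↥R, Sum.inl v ∈ (current R r.odd η).sources ↔ v = u) ∧
    (current R r.odd η).backboneEnd (latticeRank (pos R)) (Sum.inr r.entry) (Sum.inl u) =
      Sum.inl u

/-- **A compatible local run enters through the entry bond**: it starts at the entry stub and
its second vertex is the inner end of the entry arrow. [folklore] -/
theorem exists_localBackbone_eq_cons_cons (r : Row R k) (u : ↥R) (η : Finset (Sym2 (Site 3)))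
    (h : Compatible r u η) :
    ∃ l : List (Vertex R), localBackbone r u η =
      Sum.inr r.entry :: Sum.inl ⟨r.entry.1.1, (mem_arrows_iff.1 r.entry.2).1⟩ :: l := by
  have hhead := Current.head?_backbone (rank := latticeRank (pos R)) (n := current R r.odd η)
    (a := Sum.inr r.entry) (z := Sum.inl u)
  have hchain := Current.isChain_adj_backbone (rank := latticeRank (pos R))
    (n := current R r.odd η) (a := Sum.inr r.entry) (z := Sum.inl u)
  have hlast : ((current R r.odd η).backbone (latticeRank (pos R)) (Sum.inr r.entry)
      (Sum.inl u)).getLast? = some (Sum.inl u) := by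
    rw [List.getLast?_eq_some_getLast Current.backbone_ne_nil, Current.getLast_backbone, h.2]
  unfold localBackbone
  generalize (current R r.odd η).backbone (latticeRank (pos R)) (Sum.inr r.entry) (Sum.inl u) = bb
    at hhead hchain hlast
  rcases bb with _ | ⟨a, _ | ⟨b, l⟩⟩
  · simp at hhead
  · simp only [List.head?_cons, List.getLast?_singleton, Option.some.injEq] at hhead hlast
    exact absurd (hhead.symm.trans hlast) Sum.inr_ne_inl
  · simp only [List.head?_cons, Option.some.injEq] at hhead
    subst hhead
    have hadj := (List.isChain_cons_cons.1 hchain).1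
    rcases b with x | q
    · have hx : x = ⟨r.entry.1.1, (mem_arrows_iff.1 r.entry.2).1⟩ :=
        Subtype.ext (graph_adj_inr_inl.1 hadj).symm
      subst hx
      exact ⟨l, rfl⟩
    · exact absurd hadj not_graph_adj_inr_inr

/-- Hence **the local backbone word of a compatible configuration is the incoming word, then the
entry step `e.1 - e.2`, then the inside steps.** [folklore] -/
theorem exists_word_eq_append_cons (r : Row R k) (u : ↥R) (η : Finset (Sym2 (Site 3)))
    (h : Compatible r u η) :
    ∃ L : List (Site 3), word r u η = r.incoming ++ (r.entry.1.1 - r.entry.1.2) :: L := by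
  obtain ⟨l, hl⟩ := exists_localBackbone_eq_cons_cons r u η h
  refine ⟨steps (r.entry.1.1 :: l.map (pos R)), ?_⟩
  rw [word, hl]
  rfl

/-- **Principal rows.** When the entry arrow is the only odd boundary bond (`P = {e}`), the
local run cannot leave the region and, by Aizenman's parity observation
(`Current.backboneEnd_eq_of_sources_eq`), it ends at the probe as soon as the degree condition
holds: compatibility is the degree condition alone. [folklore] -/
theorem compatible_iff_of_odd_eq_singleton (r : Row R k) (hr : r.odd = {r.entry}) (u : ↥R)
    (η : Finset (Sym2 (Site 3))) :
    Compatible r u η ↔ ∀ v : ↥R, Sum.inl v ∈ (current R r.odd η).sources ↔ v = u := by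
  refine ⟨And.left, fun h => ⟨h, Current.backboneEnd_eq_of_sources_eq ?_⟩⟩
  ext x
  rw [Finset.mem_symmDiff, mem_singleton, mem_singleton]
  rcases x with v | p
  · rw [h v]
    constructor
    · rintro rfl
      exact Or.inr ⟨rfl, Sum.inl_ne_inr⟩
    · rintro (⟨h1, _⟩ | ⟨h1, _⟩)
      · exact absurd h1 Sum.inl_ne_inr
      · exact Sum.inl_injective h1
  · rw [inr_mem_sources_current_iff, hr, mem_singleton]
    constructor
    · rintro rfl
      exact Or.inl ⟨rfl, Sum.inr_ne_inl⟩
    · rintro (⟨h1, _⟩ | ⟨h1, _⟩)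
      · exact Sum.inr_injective h1
      · exact absurd h1 Sum.inr_ne_inl

end LocalIdentity

open LocalIdentity

open scoped Classical in
/-- **The local identity matrix `M_{R,𝒜_k}`** of the `SU(2)`-decorated current observable
(posited object of route `DiracCensus`, notion `LocalIdentityMatrix`). Rows `(π, i)`: boundary
pattern `π = (P, e, ι)` of the region `R` and spinor index `i`; columns `((u, α), j)`: probe
`u ∈ R`, decoration `α ∈ 𝒜_k`, spinor index `j`; entry: the local partition polynomial
`∑ X^{|η|} Hol(ι · γ_loc(η))_{ij}` over the inside parity configurations `η ⊆ E(R)` compatible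
with `(π, u)` whose local backbone word has decoration `α` of depth `k`. A coefficient family
`c_{u,α} ∈ ℂ²` is *locally certified* at `t` when `(M.map (eval t)) c = 0`; see the module
docstring for what this does and does not certify. [folklore] -/
def localIdentityMatrix (R : Finset (Site 3)) (k : ℕ) :
    Matrix (Row R k × Fin 2) (Col R k × Fin 2) ℂ[X] :=
  Matrix.of fun ri cj =>
    ∑ η ∈ (edgesIn (zdGraph 3) R).powerset,
      if Compatible ri.1 cj.1.1 η ∧ decoration k (word ri.1 cj.1.1 η) = cj.1.2.1 then
        Polynomial.C (holonomy (word ri.1 cj.1.1 η) ri.2 cj.2) * Polynomial.X ^ η.card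
      else 0

open scoped Classical in
/-- Unfolding of `localIdentityMatrix`. [folklore] -/
theorem localIdentityMatrix_apply (R : Finset (Site 3)) (k : ℕ) (ri : Row R k × Fin 2)
    (cj : Col R k × Fin 2) :
    localIdentityMatrix R k ri cj =
      ∑ η ∈ (edgesIn (zdGraph 3) R).powerset,
        if Compatible ri.1 cj.1.1 η ∧ decoration k (word ri.1 cj.1.1 η) = cj.1.2.1 then
          Polynomial.C (holonomy (word ri.1 cj.1.1 η) ri.2 cj.2) * Polynomial.X ^ η.card
        else 0 := rfl

open scoped Classical in
/-- **The matrix at parameter `t`**: evaluating the entries at `X = t` gives the local partition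
sums `∑_{η compatible, dec = α} t^{|η|} Hol(ι · γ_loc(η))_{ij}`. [folklore] -/
theorem localIdentityMatrix_map_eval (R : Finset (Site 3)) (k : ℕ) (t : ℂ)
    (ri : Row R k × Fin 2) (cj : Col R k × Fin 2) :
    (localIdentityMatrix R k).map (Polynomial.eval t) ri cj =
      ∑ η ∈ (edgesIn (zdGraph 3) R).powerset,
        if Compatible ri.1 cj.1.1 η ∧ decoration k (word ri.1 cj.1.1 η) = cj.1.2.1 then
          holonomy (word ri.1 cj.1.1 η) ri.2 cj.2 * t ^ η.card
        else 0 := by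
  rw [Matrix.map_apply, localIdentityMatrix_apply, Polynomial.eval_finsetSum]
  refine Finset.sum_congr rfl fun η _ => ?_
  split_ifs
  · rw [Polynomial.eval_mul, Polynomial.eval_C, Polynomial.eval_pow, Polynomial.eval_X]
  · rw [Polynomial.eval_zero]

/-- The column index type is non-empty as soon as the region is. [folklore] -/
theorem nonempty_col {R : Finset (Site 3)} (hR : R.Nonempty) (k : ℕ) : Nonempty (Col R k) :=
  let ⟨u, hu⟩ := hR
  ⟨(⟨u, hu⟩, ⟨_, unitVec_one_mem_decorationAlphabet k (0, true)⟩)⟩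

end Literature.Probability.LatticeModels

end
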